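import Mathlib.Tactic.Ring
import Mathlib.Tactic.Linarith
import Mathlib.Tactic.Positivity
import Mathlib.Tactic.LinearCombination
import Mathlib.Data.Real.Basic
import Mathlib.Analysis.Real.Sqrt
import Summits.HodgeConjecture.HodgeConjecture.Theorems.WeilClassTestFormatFourTwoLambda
import Summits.HodgeConjecture.HodgeConjecture.Theorems.WeilClassTestThreePhase
import HarnessLib

/-!
# CONJECTURE N IN FORMAT (4,2) FOR COMPLEX CHARGES — `conjectureN_42_complex` (hodge-weil ladder, GAPS G51c)

Prover 2, generation 14 (note `run/shared/lean/b2b/hodge-weil/b2b-hweil-pv2-g14/THREE-PHASE-G14.md`). Setting (dictionary (G) of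
`Literature/AlgebraicGeometry/HodgeTheory/WeilClassTestChargeZeroLemma.lean`, `CHARGE-ZERO-LEMMA.md` §1, `CONJECTURE-N.md` §§1, 6):
a corank-one determinantal design of format (4,2) in CENTRED coordinates — E-roots with positions `A_e` and complex charges
`C_e = u_e + i·x_e` (`e = 1..4`), F-roots with positions `B_f` and charges `D_f = v_f + i·y_f` (`f = 1,2`); centring `ΣA = ΣB`,
`ΣC = ΣD`; PURITY of `c₃(E − F)`: (P1) `ΣεA²C = 0`, (P2) `ΣεAC² = 0`, (P3) `ΣεA|C|² = 0`, (P4) `ΣεC|C|² = 0` (real and imaginary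
parts written out); PAIRWISE AMPLENESS at scale one `|C_e − D_f| ≤ A_e − B_f`; the charge-0 class-test quantity `G₀ = Q₂ + Q₄`,
`Q₂(A;C) = ½(ΣεA²)(Σε|C|²) + |ΣεAC|² − 3ΣεA²|C|²`, `Q₄(C) = 3Σε|C|⁴ − (Σε|C|²)² − ½|ΣεC²|²`.
THEOREM (`conjectureN_42_complex`): `G₀ ≥ 0` — NO pure pairwise-ample corank-one determinantal design of format (4,2), real OR complex
charges, passes the charge-0 component `(V)₀` of the survival test strictly inside its ample range (door A, format (4,2), every `d`).
More precisely (`conjectureN_42_complex_lambda`) `Q₂(A;C) + μ·Q₄(C) ≥ 0` for every `μ ≥ 0` with `16μ² ≤ 72μ + 27` (`μ ≤ (9 + 6√3)/4`).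
PROOF = THREE-PHASE REDUCTION (`WeilClassTestThreePhase.lean`) + the sharp real theorem with `λ = 4μ/3` (`WeilClassTestFormatFourTwoLambda.lean`):
choose `θ` with `a·cos 3θ + b·sin 3θ = 0` (`a = Σεu³`, `b = Σεx³`); the three real projections `w_j = Re(e^{iθ_j}C)`, `θ_j = θ + 2πj/3`,
are centred, real-pure (P1, P2, P4 — (P4) because `Σεw_j³ = a cos3θ_j + b sin3θ_j` by the complex (P4)) and pairwise ample
(`real_projection`), so each satisfies `Q₂(A;w_j) + (4μ/3)Q₄(w_j) ≥ 0`; the three-phase identity averages these into the complex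
inequality. Pure algebra + `Complex.arg`; `ring` on the two dictionary identities needs a raised heartbeat budget (size only).
Nothing here is a case of HC, a rung or a door edge (C22); no statement of Markman's papers is used. New cell result ⇒ Summits/.
-/

set_option linter.dupNamespace false

namespace Summit.HodgeConjecture.HodgeConjecture.WeilClassTestFormatFourTwoComplex

open Summit.HodgeConjecture.HodgeConjecture.WeilClassTestFormatFourTwoLambda
open Summit.HodgeConjecture.HodgeConjecture.WeilClassTestThreePhase

set_option maxHeartbeats 800000 in
/-- PROJECTION DICTIONARY: for the real charge vector `w = c·u − s·x` (E and F alike), `Q₂(A;w) + (4μ/3)·Q₄(w)` equals the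
moment form `q₂(c,s) + (4μ/3)·q₄(c,s)` of `WeilClassTestThreePhase` with the (4,2) signed moments substituted. -/
theorem proj_comb (A₁ A₂ A₃ A₄ B₁ B₂ u₁ u₂ u₃ u₄ v₁ v₂ x₁ x₂ x₃ x₄ y₁ y₂ : ℝ) (c s μ : ℝ) :
    (1 / 2) * ((A₁ ^ 2 + A₂ ^ 2 + A₃ ^ 2 + A₄ ^ 2) - (B₁ ^ 2 + B₂ ^ 2)) * (((c * u₁ - s * x₁) ^ 2 + (c * u₂ - s * x₂) ^ 2 + (c * u₃ - s * x₃) ^ 2 + (c * u₄ - s * x₄) ^ 2) - ((c * v₁ - s * y₁) ^ 2 + (c * v₂ - s * y₂) ^ 2))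
        + ((A₁ * (c * u₁ - s * x₁) + A₂ * (c * u₂ - s * x₂) + A₃ * (c * u₃ - s * x₃) + A₄ * (c * u₄ - s * x₄)) - (B₁ * (c * v₁ - s * y₁) + B₂ * (c * v₂ - s * y₂))) ^ 2
        - 3 * ((A₁ ^ 2 * (c * u₁ - s * x₁) ^ 2 + A₂ ^ 2 * (c * u₂ - s * x₂) ^ 2 + A₃ ^ 2 * (c * u₃ - s * x₃) ^ 2 + A₄ ^ 2 * (c * u₄ - s * x₄) ^ 2) - (B₁ ^ 2 * (c * v₁ - s * y₁) ^ 2 + B₂ ^ 2 * (c * v₂ - s * y₂) ^ 2))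
      + 4 * μ / 3 * (3 * (((c * u₁ - s * x₁) ^ 4 + (c * u₂ - s * x₂) ^ 4 + (c * u₃ - s * x₃) ^ 4 + (c * u₄ - s * x₄) ^ 4) - ((c * v₁ - s * y₁) ^ 4 + (c * v₂ - s * y₂) ^ 4)) - (3 / 2) * (((c * u₁ - s * x₁) ^ 2 + (c * u₂ - s * x₂) ^ 2 + (c * u₃ - s * x₃) ^ 2 + (c * u₄ - s * x₄) ^ 2) - ((c * v₁ - s * y₁) ^ 2 + (c * v₂ - s * y₂) ^ 2)) ^ 2)
      = ((1 / 2) * ((A₁ ^ 2 + A₂ ^ 2 + A₃ ^ 2 + A₄ ^ 2) - (B₁ ^ 2 + B₂ ^ 2) : ℝ) * (c ^ 2 * ((u₁ ^ 2 + u₂ ^ 2 + u₃ ^ 2 + u₄ ^ 2) - (v₁ ^ 2 + v₂ ^ 2) : ℝ) - 2 * c * s * ((u₁ * x₁ + u₂ * x₂ + u₃ * x₃ + u₄ * x₄) - (v₁ * y₁ + v₂ * y₂) : ℝ) + s ^ 2 * ((x₁ ^ 2 + x₂ ^ 2 + x₃ ^ 2 + x₄ ^ 2) - (y₁ ^ 2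 + y₂ ^ 2) : ℝ)) + (c * ((A₁ * u₁ + A₂ * u₂ + A₃ * u₃ + A₄ * u₄) - (B₁ * v₁ + B₂ * v₂) : ℝ) - s * ((A₁ * x₁ + A₂ * x₂ + A₃ * x₃ + A₄ * x₄) - (B₁ * y₁ + B₂ * y₂) : ℝ)) ^ 2 - 3 * (c ^ 2 * ((A₁ ^ 2 * u₁ ^ 2 + A₂ ^ 2 * u₂ ^ 2 + A₃ ^ 2 * u₃ ^ 2 + A₄ ^ 2 * u₄ ^ 2) - (B₁ ^ 2 * v₁ ^ 2 + B₂ ^ 2 * v₂ ^ 2) : ℝ) - 2 * c * s * ((A₁ ^ 2 * (u₁ * x₁) + A₂ ^ 2 * (u₂ * x₂) + A₃ ^ 2 * (u₃ * x₃) + A₄ ^ 2 * (u₄ * x₄)) - (B₁ ^ 2 * (v₁ * y₁) + B₂ ^ 2 * (v₂ * y₂)) : ℝ) + s ^ 2 * ((A₁ ^ 2 * x₁ ^ 2 + A₂ ^ 2 * x₂ ^ 2 + A₃ ^ 2 * x₃ ^ 2 + A₄ ^ 2 * x₄ ^ 2) - (B₁ ^ 2 * y₁ ^ 2 + B₂ ^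 2 * y₂ ^ 2) : ℝ))
        + 4 * μ / 3 * (3 * (c ^ 4 * ((u₁ ^ 4 + u₂ ^ 4 + u₃ ^ 4 + u₄ ^ 4) - (v₁ ^ 4 + v₂ ^ 4) : ℝ) - 4 * c ^ 3 * s * ((u₁ ^ 3 * x₁ + u₂ ^ 3 * x₂ + u₃ ^ 3 * x₃ + u₄ ^ 3 * x₄) - (v₁ ^ 3 * y₁ + v₂ ^ 3 * y₂) : ℝ) + 6 * c ^ 2 * s ^ 2 * ((u₁ ^ 2 * x₁ ^ 2 + u₂ ^ 2 * x₂ ^ 2 + u₃ ^ 2 * x₃ ^ 2 + u₄ ^ 2 * x₄ ^ 2) - (v₁ ^ 2 * y₁ ^ 2 + v₂ ^ 2 * y₂ ^ 2) : ℝ) - 4 * c * s ^ 3 * ((u₁ * x₁ ^ 3 + u₂ * x₂ ^ 3 + u₃ * x₃ ^ 3 + u₄ * x₄ ^ 3) - (v₁ * y₁ ^ 3 + v₂ * y₂ ^ 3) : ℝ) + s ^ 4 * ((x₁ ^ 4 + x₂ ^ 4 + x₃ ^ 4 + x₄ ^ 4) - (y₁ ^ 4 + y₂ ^ 4) : ℝ))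 - (3 / 2) * (c ^ 2 * ((u₁ ^ 2 + u₂ ^ 2 + u₃ ^ 2 + u₄ ^ 2) - (v₁ ^ 2 + v₂ ^ 2) : ℝ) - 2 * c * s * ((u₁ * x₁ + u₂ * x₂ + u₃ * x₃ + u₄ * x₄) - (v₁ * y₁ + v₂ * y₂) : ℝ) + s ^ 2 * ((x₁ ^ 2 + x₂ ^ 2 + x₃ ^ 2 + x₄ ^ 2) - (y₁ ^ 2 + y₂ ^ 2) : ℝ)) ^ 2)) := by
  ring

set_option maxHeartbeats 800000 in
/-- COMPLEX DICTIONARY: `Q₂(A;C) + μ·Q₄(C)` in coordinates equals the moment form of `WeilClassTestThreePhase`. -/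
theorem complex_form_eq (A₁ A₂ A₃ A₄ B₁ B₂ u₁ u₂ u₃ u₄ v₁ v₂ x₁ x₂ x₃ x₄ y₁ y₂ : ℝ) (μ : ℝ) :
    (1 / 2) * ((A₁ ^ 2 + A₂ ^ 2 + A₃ ^ 2 + A₄ ^ 2) - (B₁ ^ 2 + B₂ ^ 2) : ℝ) * (((u₁ ^ 2 + x₁ ^ 2) + (u₂ ^ 2 + x₂ ^ 2) + (u₃ ^ 2 + x₃ ^ 2) + (u₄ ^ 2 + x₄ ^ 2)) - ((v₁ ^ 2 + y₁ ^ 2) + (v₂ ^ 2 + y₂ ^ 2)) : ℝ)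
        + (((A₁ * u₁ + A₂ * u₂ + A₃ * u₃ + A₄ * u₄) - (B₁ * v₁ + B₂ * v₂) : ℝ) ^ 2 + ((A₁ * x₁ + A₂ * x₂ + A₃ * x₃ + A₄ * x₄) - (B₁ * y₁ + B₂ * y₂) : ℝ) ^ 2)
        - 3 * ((A₁ ^ 2 * (u₁ ^ 2 + x₁ ^ 2) + A₂ ^ 2 * (u₂ ^ 2 + x₂ ^ 2) + A₃ ^ 2 * (u₃ ^ 2 + x₃ ^ 2) + A₄ ^ 2 * (u₄ ^ 2 + x₄ ^ 2)) - (B₁ ^ 2 * (v₁ ^ 2 + y₁ ^ 2) + B₂ ^ 2 * (v₂ ^ 2 + y₂ ^ 2)) : ℝ)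
      + μ * (3 * (((u₁ ^ 2 + x₁ ^ 2) ^ 2 + (u₂ ^ 2 + x₂ ^ 2) ^ 2 + (u₃ ^ 2 + x₃ ^ 2) ^ 2 + (u₄ ^ 2 + x₄ ^ 2) ^ 2) - ((v₁ ^ 2 + y₁ ^ 2) ^ 2 + (v₂ ^ 2 + y₂ ^ 2) ^ 2) : ℝ)
        - (((u₁ ^ 2 + x₁ ^ 2) + (u₂ ^ 2 + x₂ ^ 2) + (u₃ ^ 2 + x₃ ^ 2) + (u₄ ^ 2 + x₄ ^ 2)) - ((v₁ ^ 2 + y₁ ^ 2) + (v₂ ^ 2 + y₂ ^ 2)) : ℝ) ^ 2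
        - (1 / 2) * ((((u₁ ^ 2 - x₁ ^ 2) + (u₂ ^ 2 - x₂ ^ 2) + (u₃ ^ 2 - x₃ ^ 2) + (u₄ ^ 2 - x₄ ^ 2)) - ((v₁ ^ 2 - y₁ ^ 2) + (v₂ ^ 2 - y₂ ^ 2)) : ℝ) ^ 2 + ((2 * u₁ * x₁ + 2 * u₂ * x₂ + 2 * u₃ * x₃ + 2 * u₄ * x₄) - (2 * v₁ * y₁ + 2 * v₂ * y₂) : ℝ) ^ 2))
      = ((1 / 2) * ((A₁ ^ 2 + A₂ ^ 2 + A₃ ^ 2 + A₄ ^ 2) - (B₁ ^ 2 + B₂ ^ 2) : ℝ) * (((u₁ ^ 2 + u₂ ^ 2 + u₃ ^ 2 + u₄ ^ 2) - (v₁ ^ 2 + v₂ ^ 2) : ℝ) + ((x₁ ^ 2 + x₂ ^ 2 + x₃ ^ 2 + x₄ ^ 2) - (y₁ ^ 2 + y₂ ^ 2) : ℝ)) + (((A₁ * u₁ + A₂ * u₂ + A₃ * u₃ + A₄ * u₄) - (B₁ * v₁ + B₂ * v₂) : ℝ) ^ 2 + ((A₁ * x₁ + A₂ * x₂ + A₃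 * x₃ + A₄ * x₄) - (B₁ * y₁ + B₂ * y₂) : ℝ) ^ 2) - 3 * (((A₁ ^ 2 * u₁ ^ 2 + A₂ ^ 2 * u₂ ^ 2 + A₃ ^ 2 * u₃ ^ 2 + A₄ ^ 2 * u₄ ^ 2) - (B₁ ^ 2 * v₁ ^ 2 + B₂ ^ 2 * v₂ ^ 2) : ℝ) + ((A₁ ^ 2 * x₁ ^ 2 + A₂ ^ 2 * x₂ ^ 2 + A₃ ^ 2 * x₃ ^ 2 + A₄ ^ 2 * x₄ ^ 2) - (B₁ ^ 2 * y₁ ^ 2 + B₂ ^ 2 * y₂ ^ 2) : ℝ)))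
      + μ * (3 * (((u₁ ^ 4 + u₂ ^ 4 + u₃ ^ 4 + u₄ ^ 4) - (v₁ ^ 4 + v₂ ^ 4) : ℝ) + 2 * ((u₁ ^ 2 * x₁ ^ 2 + u₂ ^ 2 * x₂ ^ 2 + u₃ ^ 2 * x₃ ^ 2 + u₄ ^ 2 * x₄ ^ 2) - (v₁ ^ 2 * y₁ ^ 2 + v₂ ^ 2 * y₂ ^ 2) : ℝ) + ((x₁ ^ 4 + x₂ ^ 4 + x₃ ^ 4 + x₄ ^ 4) - (y₁ ^ 4 + y₂ ^ 4) : ℝ)) - (((u₁ ^ 2 + u₂ ^ 2 + u₃ ^ 2 + u₄ ^ 2) - (v₁ ^ 2 + v₂ ^ 2) : ℝ) + ((x₁ ^ 2 + x₂ ^ 2 + x₃ ^ 2 + x₄ ^ 2) - (y₁ ^ 2 + y₂ ^ 2) : ℝ)) ^ 2 - (1 / 2) * ((((u₁ ^ 2 + u₂ ^ 2 + u₃ ^ 2 + u₄ ^ 2) - (v₁ ^ 2 + v₂ ^ 2) : ℝ) - ((x₁ ^ 2 + x₂ ^ 2 + x₃ ^ 2 + x₄ ^ 2) - (y₁ ^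 2 + y₂ ^ 2) : ℝ)) ^ 2 + 4 * ((u₁ * x₁ + u₂ * x₂ + u₃ * x₃ + u₄ * x₄) - (v₁ * y₁ + v₂ * y₂) : ℝ) ^ 2)) := by
  ring

set_option maxHeartbeats 800000 in
/-- THE REAL PROJECTION of a centred, pure, pairwise-ample complex (4,2) configuration along a unit direction `(c,s)` with
`a·(c³ − 3cs²) + b·(3c²s − s³) = 0` (`a = Σεu³`, `b = Σεx³`) is a centred, real-pure, pairwise-ample real (4,2) configuration, hence
(sharp real theorem, `λ = 4μ/3`) `q₂(c,s) + (4μ/3)·q₄(c,s) ≥ 0`. -/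
theorem real_projection (A₁ A₂ A₃ A₄ B₁ B₂ u₁ u₂ u₃ u₄ v₁ v₂ x₁ x₂ x₃ x₄ y₁ y₂ : ℝ)
    (hA : A₁ + A₂ + A₃ + A₄ = B₁ + B₂) (hCre : u₁ + u₂ + u₃ + u₄ = v₁ + v₂) (hCim : x₁ + x₂ + x₃ + x₄ = y₁ + y₂)
    (hP1re : ((A₁ ^ 2 * u₁ + A₂ ^ 2 * u₂ + A₃ ^ 2 * u₃ + A₄ ^ 2 * u₄) - (B₁ ^ 2 * v₁ + B₂ ^ 2 * v₂) : ℝ) = 0)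
    (hP1im : ((A₁ ^ 2 * x₁ + A₂ ^ 2 * x₂ + A₃ ^ 2 * x₃ + A₄ ^ 2 * x₄) - (B₁ ^ 2 * y₁ + B₂ ^ 2 * y₂) : ℝ) = 0)
    (hP2re : ((A₁ * (u₁ ^ 2 - x₁ ^ 2) + A₂ * (u₂ ^ 2 - x₂ ^ 2) + A₃ * (u₃ ^ 2 - x₃ ^ 2) + A₄ * (u₄ ^ 2 - x₄ ^ 2)) - (B₁ * (v₁ ^ 2 - y₁ ^ 2) + B₂ * (v₂ ^ 2 - y₂ ^ 2)) : ℝ) = 0)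
    (hP2im : ((A₁ * (2 * u₁ * x₁) + A₂ * (2 * u₂ * x₂) + A₃ * (2 * u₃ * x₃) + A₄ * (2 * u₄ * x₄)) - (B₁ * (2 * v₁ * y₁) + B₂ * (2 * v₂ * y₂)) : ℝ) = 0)
    (hP3 : ((A₁ * (u₁ ^ 2 + x₁ ^ 2) + A₂ * (u₂ ^ 2 + x₂ ^ 2) + A₃ * (u₃ ^ 2 + x₃ ^ 2) + A₄ * (u₄ ^ 2 + x₄ ^ 2)) - (B₁ * (v₁ ^ 2 + y₁ ^ 2) + B₂ * (v₂ ^ 2 + y₂ ^ 2)) : ℝ) = 0)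
    (hP4re : ((u₁ * (u₁ ^ 2 + x₁ ^ 2) + u₂ * (u₂ ^ 2 + x₂ ^ 2) + u₃ * (u₃ ^ 2 + x₃ ^ 2) + u₄ * (u₄ ^ 2 + x₄ ^ 2)) - (v₁ * (v₁ ^ 2 + y₁ ^ 2) + v₂ * (v₂ ^ 2 + y₂ ^ 2)) : ℝ) = 0)
    (hP4im : ((x₁ * (u₁ ^ 2 + x₁ ^ 2) + x₂ * (u₂ ^ 2 + x₂ ^ 2) + x₃ * (u₃ ^ 2 + x₃ ^ 2) + x₄ * (u₄ ^ 2 + x₄ ^ 2)) - (y₁ * (v₁ ^ 2 + y₁ ^ 2) + y₂ * (v₂ ^ 2 + y₂ ^ 2)) : ℝ) = 0)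
    (m₁₁ : Real.sqrt ((u₁ - v₁) ^ 2 + (x₁ - y₁) ^ 2) ≤ A₁ - B₁) (m₂₁ : Real.sqrt ((u₂ - v₁) ^ 2 + (x₂ - y₁) ^ 2) ≤ A₂ - B₁)
    (m₃₁ : Real.sqrt ((u₃ - v₁) ^ 2 + (x₃ - y₁) ^ 2) ≤ A₃ - B₁) (m₄₁ : Real.sqrt ((u₄ - v₁) ^ 2 + (x₄ - y₁) ^ 2) ≤ A₄ - B₁)
    (m₁₂ : Real.sqrt ((u₁ - v₂) ^ 2 + (x₁ - y₂) ^ 2) ≤ A₁ - B₂) (m₂₂ : Real.sqrt ((u₂ - v₂) ^ 2 + (x₂ - y₂) ^ 2) ≤ A₂ - B₂)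
    (m₃₂ : Real.sqrt ((u₃ - v₂) ^ 2 + (x₃ - y₂) ^ 2) ≤ A₃ - B₂) (m₄₂ : Real.sqrt ((u₄ - v₂) ^ 2 + (x₄ - y₂) ^ 2) ≤ A₄ - B₂)
    (μ : ℝ) (hμ : 0 ≤ μ) (hμ' : 16 * μ ^ 2 ≤ 72 * μ + 27)
    (c s : ℝ) (hcs : c ^ 2 + s ^ 2 = 1)
    (hang : ((u₁ ^ 3 + u₂ ^ 3 + u₃ ^ 3 + u₄ ^ 3) - (v₁ ^ 3 + v₂ ^ 3) : ℝ) * (c ^ 3 - 3 * c * s ^ 2)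
      + ((x₁ ^ 3 + x₂ ^ 3 + x₃ ^ 3 + x₄ ^ 3) - (y₁ ^ 3 + y₂ ^ 3) : ℝ) * (3 * c ^ 2 * s - s ^ 3) = 0) :
    0 ≤ ((1 / 2) * ((A₁ ^ 2 + A₂ ^ 2 + A₃ ^ 2 + A₄ ^ 2) - (B₁ ^ 2 + B₂ ^ 2) : ℝ) * (c ^ 2 * ((u₁ ^ 2 + u₂ ^ 2 + u₃ ^ 2 + u₄ ^ 2) - (v₁ ^ 2 + v₂ ^ 2) : ℝ) - 2 * c * s * ((u₁ * x₁ + u₂ * x₂ + u₃ * x₃ + u₄ * x₄) - (v₁ * y₁ + v₂ * y₂) : ℝ) + s ^ 2 * ((x₁ ^ 2 + x₂ ^ 2 + x₃ ^ 2 + x₄ ^ 2) - (y₁ ^ 2 + y₂ ^ 2) : ℝ)) + (c * ((A₁ * u₁ + A₂ * u₂ + A₃ * u₃ + A₄ * u₄) - (B₁ * v₁ + B₂ * v₂) : ℝ) - s * ((A₁ * x₁ + A₂ * x₂ + A₃ * x₃ + A₄ * x₄) - (B₁ * y₁ + B₂ * y₂) : ℝ)) ^ 2 - 3 * (c ^ 2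 * ((A₁ ^ 2 * u₁ ^ 2 + A₂ ^ 2 * u₂ ^ 2 + A₃ ^ 2 * u₃ ^ 2 + A₄ ^ 2 * u₄ ^ 2) - (B₁ ^ 2 * v₁ ^ 2 + B₂ ^ 2 * v₂ ^ 2) : ℝ) - 2 * c * s * ((A₁ ^ 2 * (u₁ * x₁) + A₂ ^ 2 * (u₂ * x₂) + A₃ ^ 2 * (u₃ * x₃) + A₄ ^ 2 * (u₄ * x₄)) - (B₁ ^ 2 * (v₁ * y₁) + B₂ ^ 2 * (v₂ * y₂)) : ℝ) + s ^ 2 * ((A₁ ^ 2 * x₁ ^ 2 + A₂ ^ 2 * x₂ ^ 2 + A₃ ^ 2 * x₃ ^ 2 + A₄ ^ 2 * x₄ ^ 2) - (B₁ ^ 2 * y₁ ^ 2 + B₂ ^ 2 * y₂ ^ 2) : ℝ))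
        + 4 * μ / 3 * (3 * (c ^ 4 * ((u₁ ^ 4 + u₂ ^ 4 + u₃ ^ 4 + u₄ ^ 4) - (v₁ ^ 4 + v₂ ^ 4) : ℝ) - 4 * c ^ 3 * s * ((u₁ ^ 3 * x₁ + u₂ ^ 3 * x₂ + u₃ ^ 3 * x₃ + u₄ ^ 3 * x₄) - (v₁ ^ 3 * y₁ + v₂ ^ 3 * y₂) : ℝ) + 6 * c ^ 2 * s ^ 2 * ((u₁ ^ 2 * x₁ ^ 2 + u₂ ^ 2 * x₂ ^ 2 + u₃ ^ 2 * x₃ ^ 2 + u₄ ^ 2 * x₄ ^ 2) - (v₁ ^ 2 * y₁ ^ 2 + v₂ ^ 2 * y₂ ^ 2) : ℝ) - 4 * c * s ^ 3 * ((u₁ * x₁ ^ 3 + u₂ * x₂ ^ 3 + u₃ * x₃ ^ 3 + u₄ * x₄ ^ 3) - (v₁ * y₁ ^ 3 + v₂ * y₂ ^ 3) : ℝ) + s ^ 4 * ((x₁ ^ 4 + x₂ ^ 4 + x₃ ^ 4 + x₄ ^ 4) - (y₁ ^ 4 + y₂ ^ 4) : ℝ)) - (3 / 2) * (c ^ 2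 * ((u₁ ^ 2 + u₂ ^ 2 + u₃ ^ 2 + u₄ ^ 2) - (v₁ ^ 2 + v₂ ^ 2) : ℝ) - 2 * c * s * ((u₁ * x₁ + u₂ * x₂ + u₃ * x₃ + u₄ * x₄) - (v₁ * y₁ + v₂ * y₂) : ℝ) + s ^ 2 * ((x₁ ^ 2 + x₂ ^ 2 + x₃ ^ 2 + x₄ ^ 2) - (y₁ ^ 2 + y₂ ^ 2) : ℝ)) ^ 2)) := by
  have hl : 0 ≤ 4 * μ / 3 := by positivity
  have hl' : (4 * μ / 3) ^ 2 ≤ 6 * (4 * μ / 3) + 3 := by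
    have e1 : (4 * μ / 3) ^ 2 = (16 * μ ^ 2) / 9 := by ring
    have e2 : 6 * (4 * μ / 3) + 3 = (72 * μ + 27) / 9 := by ring
    rw [e1, e2]
    exact div_le_div_of_nonneg_right hμ' (by norm_num)
  have h := conjectureN_42_lambda A₁ A₂ A₃ A₄ B₁ B₂ (c * u₁ - s * x₁) (c * u₂ - s * x₂) (c * u₃ - s * x₃) (c * u₄ - s * x₄) (c * v₁ - s * y₁) (c * v₂ - s * y₂)
    hA (by linear_combination c * hCre - s * hCim) (by linear_combination c * hP1re - s * hP1im)
    (by linear_combination ((c ^ 2 + s ^ 2) / 2) * hP3 + ((c ^ 2 - s ^ 2) / 2) * hP2re - (c * s) * hP2im)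
    (by linear_combination hang + (3 * c * s ^ 2) * hP4re - (3 * c ^ 2 * s) * hP4im)
    (proj_amp c s u₁ x₁ v₁ y₁ (A₁ - B₁) hcs m₁₁) (proj_amp c s u₂ x₂ v₁ y₁ (A₂ - B₁) hcs m₂₁) (proj_amp c s u₃ x₃ v₁ y₁ (A₃ - B₁) hcs m₃₁) (proj_amp c s u₄ x₄ v₁ y₁ (A₄ - B₁) hcs m₄₁) (proj_amp c s u₁ x₁ v₂ y₂ (A₁ - B₂) hcs m₁₂) (proj_amp c s u₂ x₂ v₂ y₂ (A₂ - B₂) hcs m₂₂) (proj_amp c s u₃ x₃ v₂ y₂ (A₃ - B₂) hcs m₃₂) (proj_amp c s u₄ x₄ v₂ y₂ (A₄ - B₂) hcs m₄₂)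
    (4 * μ / 3) hl hl'
  rw [proj_comb A₁ A₂ A₃ A₄ B₁ B₂ u₁ u₂ u₃ u₄ v₁ v₂ x₁ x₂ x₃ x₄ y₁ y₂ c s μ] at h
  exact h

set_option maxHeartbeats 400000 in
/-- **CONJECTURE N IN FORMAT (4,2), COMPLEX CHARGES, with the constant.** Centred + pure (P1–P4) + pairwise ample ⇒
`Q₂(A;C) + μ·Q₄(C) ≥ 0` for every `0 ≤ μ` with `16μ² ≤ 72μ + 27`. -/
theorem conjectureN_42_complex_lambda (A₁ A₂ A₃ A₄ B₁ B₂ u₁ u₂ u₃ u₄ v₁ v₂ x₁ x₂ x₃ x₄ y₁ y₂ : ℝ)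
    (hA : A₁ + A₂ + A₃ + A₄ = B₁ + B₂) (hCre : u₁ + u₂ + u₃ + u₄ = v₁ + v₂) (hCim : x₁ + x₂ + x₃ + x₄ = y₁ + y₂)
    (hP1re : ((A₁ ^ 2 * u₁ + A₂ ^ 2 * u₂ + A₃ ^ 2 * u₃ + A₄ ^ 2 * u₄) - (B₁ ^ 2 * v₁ + B₂ ^ 2 * v₂) : ℝ) = 0)
    (hP1im : ((A₁ ^ 2 * x₁ + A₂ ^ 2 * x₂ + A₃ ^ 2 * x₃ + A₄ ^ 2 * x₄) - (B₁ ^ 2 * y₁ + B₂ ^ 2 * y₂) : ℝ) = 0)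
    (hP2re : ((A₁ * (u₁ ^ 2 - x₁ ^ 2) + A₂ * (u₂ ^ 2 - x₂ ^ 2) + A₃ * (u₃ ^ 2 - x₃ ^ 2) + A₄ * (u₄ ^ 2 - x₄ ^ 2)) - (B₁ * (v₁ ^ 2 - y₁ ^ 2) + B₂ * (v₂ ^ 2 - y₂ ^ 2)) : ℝ) = 0)
    (hP2im : ((A₁ * (2 * u₁ * x₁) + A₂ * (2 * u₂ * x₂) + A₃ * (2 * u₃ * x₃) + A₄ * (2 * u₄ * x₄)) - (B₁ * (2 * v₁ * y₁) + B₂ * (2 * v₂ * y₂)) : ℝ) = 0)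
    (hP3 : ((A₁ * (u₁ ^ 2 + x₁ ^ 2) + A₂ * (u₂ ^ 2 + x₂ ^ 2) + A₃ * (u₃ ^ 2 + x₃ ^ 2) + A₄ * (u₄ ^ 2 + x₄ ^ 2)) - (B₁ * (v₁ ^ 2 + y₁ ^ 2) + B₂ * (v₂ ^ 2 + y₂ ^ 2)) : ℝ) = 0)
    (hP4re : ((u₁ * (u₁ ^ 2 + x₁ ^ 2) + u₂ * (u₂ ^ 2 + x₂ ^ 2) + u₃ * (u₃ ^ 2 + x₃ ^ 2) + u₄ * (u₄ ^ 2 + x₄ ^ 2)) - (v₁ * (v₁ ^ 2 + y₁ ^ 2) + v₂ * (v₂ ^ 2 + y₂ ^ 2)) : ℝ) = 0)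
    (hP4im : ((x₁ * (u₁ ^ 2 + x₁ ^ 2) + x₂ * (u₂ ^ 2 + x₂ ^ 2) + x₃ * (u₃ ^ 2 + x₃ ^ 2) + x₄ * (u₄ ^ 2 + x₄ ^ 2)) - (y₁ * (v₁ ^ 2 + y₁ ^ 2) + y₂ * (v₂ ^ 2 + y₂ ^ 2)) : ℝ) = 0)
    (m₁₁ : Real.sqrt ((u₁ - v₁) ^ 2 + (x₁ - y₁) ^ 2) ≤ A₁ - B₁) (m₂₁ : Real.sqrt ((u₂ - v₁) ^ 2 + (x₂ - y₁) ^ 2) ≤ A₂ - B₁)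
    (m₃₁ : Real.sqrt ((u₃ - v₁) ^ 2 + (x₃ - y₁) ^ 2) ≤ A₃ - B₁) (m₄₁ : Real.sqrt ((u₄ - v₁) ^ 2 + (x₄ - y₁) ^ 2) ≤ A₄ - B₁)
    (m₁₂ : Real.sqrt ((u₁ - v₂) ^ 2 + (x₁ - y₂) ^ 2) ≤ A₁ - B₂) (m₂₂ : Real.sqrt ((u₂ - v₂) ^ 2 + (x₂ - y₂) ^ 2) ≤ A₂ - B₂)
    (m₃₂ : Real.sqrt ((u₃ - v₂) ^ 2 + (x₃ - y₂) ^ 2) ≤ A₃ - B₂) (m₄₂ : Real.sqrt ((u₄ - v₂) ^ 2 + (x₄ - y₂) ^ 2) ≤ A₄ - B₂)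
    (μ : ℝ) (hμ : 0 ≤ μ) (hμ' : 16 * μ ^ 2 ≤ 72 * μ + 27) :
    0 ≤ (1 / 2) * ((A₁ ^ 2 + A₂ ^ 2 + A₃ ^ 2 + A₄ ^ 2) - (B₁ ^ 2 + B₂ ^ 2) : ℝ) * (((u₁ ^ 2 + x₁ ^ 2) + (u₂ ^ 2 + x₂ ^ 2) + (u₃ ^ 2 + x₃ ^ 2) + (u₄ ^ 2 + x₄ ^ 2)) - ((v₁ ^ 2 + y₁ ^ 2) + (v₂ ^ 2 + y₂ ^ 2)) : ℝ)
        + (((A₁ * u₁ + A₂ * u₂ + A₃ * u₃ + A₄ * u₄) - (B₁ * v₁ + B₂ * v₂) : ℝ) ^ 2 + ((A₁ * x₁ + A₂ * x₂ + A₃ * x₃ + A₄ * x₄) - (B₁ * y₁ + B₂ * y₂) : ℝ) ^ 2)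
        - 3 * ((A₁ ^ 2 * (u₁ ^ 2 + x₁ ^ 2) + A₂ ^ 2 * (u₂ ^ 2 + x₂ ^ 2) + A₃ ^ 2 * (u₃ ^ 2 + x₃ ^ 2) + A₄ ^ 2 * (u₄ ^ 2 + x₄ ^ 2)) - (B₁ ^ 2 * (v₁ ^ 2 + y₁ ^ 2) + B₂ ^ 2 * (v₂ ^ 2 + y₂ ^ 2)) : ℝ)
      + μ * (3 * (((u₁ ^ 2 + x₁ ^ 2) ^ 2 + (u₂ ^ 2 + x₂ ^ 2) ^ 2 + (u₃ ^ 2 + x₃ ^ 2) ^ 2 + (u₄ ^ 2 + x₄ ^ 2) ^ 2) - ((v₁ ^ 2 + y₁ ^ 2) ^ 2 + (v₂ ^ 2 + y₂ ^ 2) ^ 2) : ℝ)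
        - (((u₁ ^ 2 + x₁ ^ 2) + (u₂ ^ 2 + x₂ ^ 2) + (u₃ ^ 2 + x₃ ^ 2) + (u₄ ^ 2 + x₄ ^ 2)) - ((v₁ ^ 2 + y₁ ^ 2) + (v₂ ^ 2 + y₂ ^ 2)) : ℝ) ^ 2
        - (1 / 2) * ((((u₁ ^ 2 - x₁ ^ 2) + (u₂ ^ 2 - x₂ ^ 2) + (u₃ ^ 2 - x₃ ^ 2) + (u₄ ^ 2 - x₄ ^ 2)) - ((v₁ ^ 2 - y₁ ^ 2) + (v₂ ^ 2 - y₂ ^ 2)) : ℝ) ^ 2 + ((2 * u₁ * x₁ + 2 * u₂ * x₂ + 2 * u₃ * x₃ + 2 * u₄ * x₄) - (2 * v₁ * y₁ + 2 * v₂ * y₂) : ℝ) ^ 2)) := by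
  obtain ⟨c, s, hcs, hang⟩ := angle_exists ((u₁ ^ 3 + u₂ ^ 3 + u₃ ^ 3 + u₄ ^ 3) - (v₁ ^ 3 + v₂ ^ 3) : ℝ) ((x₁ ^ 3 + x₂ ^ 3 + x₃ ^ 3 + x₄ ^ 3) - (y₁ ^ 3 + y₂ ^ 3) : ℝ)
  obtain ⟨r, hr⟩ : ∃ r : ℝ, r ^ 2 = 3 := ⟨Real.sqrt 3, Real.sq_sqrt (by norm_num)⟩
  have h₀ := real_projection A₁ A₂ A₃ A₄ B₁ B₂ u₁ u₂ u₃ u₄ v₁ v₂ x₁ x₂ x₃ x₄ y₁ y₂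
    hA hCre hCim hP1re hP1im hP2re hP2im hP3 hP4re hP4im m₁₁ m₂₁ m₃₁ m₄₁ m₁₂ m₂₂ m₃₂ m₄₂ μ hμ hμ' c s hcs hang
  have hang₁ : ((u₁ ^ 3 + u₂ ^ 3 + u₃ ^ 3 + u₄ ^ 3) - (v₁ ^ 3 + v₂ ^ 3) : ℝ) * (((-c - r * s) / 2) ^ 3 - 3 * ((-c - r * s) / 2) * ((r * c - s) / 2) ^ 2)
      + ((x₁ ^ 3 + x₂ ^ 3 + x₃ ^ 3 + x₄ ^ 3) - (y₁ ^ 3 + y₂ ^ 3) : ℝ) * (3 * ((-c - r * s) / 2) ^ 2 * ((r * c - s) / 2) - ((r * c - s) / 2) ^ 3) = 0 := by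
    rw [dir_cub₁ c s r hr, dir_cub₁' c s r hr]; exact hang
  have h₁ := real_projection A₁ A₂ A₃ A₄ B₁ B₂ u₁ u₂ u₃ u₄ v₁ v₂ x₁ x₂ x₃ x₄ y₁ y₂
    hA hCre hCim hP1re hP1im hP2re hP2im hP3 hP4re hP4im m₁₁ m₂₁ m₃₁ m₄₁ m₁₂ m₂₂ m₃₂ m₄₂ μ hμ hμ' ((-c - r * s) / 2) ((r * c - s) / 2) (dir_norm₁ c s r hr hcs) hang₁
  have hang₂ : ((u₁ ^ 3 + u₂ ^ 3 + u₃ ^ 3 + u₄ ^ 3) - (v₁ ^ 3 + v₂ ^ 3) : ℝ) * (((-c + r * s) / 2) ^ 3 - 3 * ((-c + r * s) / 2) * ((-r * c - s) / 2) ^ 2)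
      + ((x₁ ^ 3 + x₂ ^ 3 + x₃ ^ 3 + x₄ ^ 3) - (y₁ ^ 3 + y₂ ^ 3) : ℝ) * (3 * ((-c + r * s) / 2) ^ 2 * ((-r * c - s) / 2) - ((-r * c - s) / 2) ^ 3) = 0 := by
    rw [dir_cub₂ c s r hr, dir_cub₂' c s r hr]; exact hang
  have h₂ := real_projection A₁ A₂ A₃ A₄ B₁ B₂ u₁ u₂ u₃ u₄ v₁ v₂ x₁ x₂ x₃ x₄ y₁ y₂
    hA hCre hCim hP1re hP1im hP2re hP2im hP3 hP4re hP4im m₁₁ m₂₁ m₃₁ m₄₁ m₁₂ m₂₂ m₃₂ m₄₂ μ hμ hμ' ((-c + r * s) / 2) ((-r * c - s) / 2) (dir_norm₂ c s r hr hcs) hang₂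
  have key := three_phase_combine ((A₁ ^ 2 + A₂ ^ 2 + A₃ ^ 2 + A₄ ^ 2) - (B₁ ^ 2 + B₂ ^ 2) : ℝ) ((u₁ ^ 2 + u₂ ^ 2 + u₃ ^ 2 + u₄ ^ 2) - (v₁ ^ 2 + v₂ ^ 2) : ℝ) ((x₁ ^ 2 + x₂ ^ 2 + x₃ ^ 2 + x₄ ^ 2) - (y₁ ^ 2 + y₂ ^ 2) : ℝ) ((u₁ * x₁ + u₂ * x₂ + u₃ * x₃ + u₄ * x₄) - (v₁ * y₁ + v₂ * y₂) : ℝ) ((A₁ * u₁ + A₂ * u₂ + A₃ * u₃ + A₄ * u₄) - (B₁ * v₁ + B₂ * v₂) : ℝ) ((A₁ * x₁ + A₂ * x₂ + A₃ * x₃ + A₄ * x₄) - (B₁ * y₁ + B₂ * y₂) : ℝ) ((A₁ ^ 2 * u₁ ^ 2 + A₂ ^ 2 * u₂ ^ 2 + A₃ ^ 2 * u₃ ^ 2 + A₄ ^ 2 * u₄ ^ 2) - (B₁ ^ 2 * v₁ ^ 2 + B₂ ^ 2 * v₂ ^ 2) : ℝ) ((A₁ ^ 2 * (u₁ * x₁)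 + A₂ ^ 2 * (u₂ * x₂) + A₃ ^ 2 * (u₃ * x₃) + A₄ ^ 2 * (u₄ * x₄)) - (B₁ ^ 2 * (v₁ * y₁) + B₂ ^ 2 * (v₂ * y₂)) : ℝ) ((A₁ ^ 2 * x₁ ^ 2 + A₂ ^ 2 * x₂ ^ 2 + A₃ ^ 2 * x₃ ^ 2 + A₄ ^ 2 * x₄ ^ 2) - (B₁ ^ 2 * y₁ ^ 2 + B₂ ^ 2 * y₂ ^ 2) : ℝ) ((u₁ ^ 4 + u₂ ^ 4 + u₃ ^ 4 + u₄ ^ 4) - (v₁ ^ 4 + v₂ ^ 4) : ℝ) ((u₁ ^ 3 * x₁ + u₂ ^ 3 * x₂ + u₃ ^ 3 * x₃ + u₄ ^ 3 * x₄) - (v₁ ^ 3 * y₁ + v₂ ^ 3 * y₂) : ℝ) ((u₁ ^ 2 * x₁ ^ 2 + u₂ ^ 2 * x₂ ^ 2 + u₃ ^ 2 * x₃ ^ 2 + u₄ ^ 2 * x₄ ^ 2) - (v₁ ^ 2 * y₁ ^ 2 + v₂ ^ 2 * y₂ ^ 2) : ℝ) ((u₁ * x₁ ^ 3 + u₂ *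 x₂ ^ 3 + u₃ * x₃ ^ 3 + u₄ * x₄ ^ 3) - (v₁ * y₁ ^ 3 + v₂ * y₂ ^ 3) : ℝ) ((x₁ ^ 4 + x₂ ^ 4 + x₃ ^ 4 + x₄ ^ 4) - (y₁ ^ 4 + y₂ ^ 4) : ℝ) c s r μ hr hcs h₀ h₁ h₂
  rw [complex_form_eq]
  exact key

/-- **CONJECTURE N IN FORMAT (4,2), COMPLEX CHARGES.** Centred + pure (P1–P4) + pairwise ample ⇒ `G₀ = Q₂(A;C) + Q₄(C) ≥ 0`. -/
theorem conjectureN_42_complex (A₁ A₂ A₃ A₄ B₁ B₂ u₁ u₂ u₃ u₄ v₁ v₂ x₁ x₂ x₃ x₄ y₁ y₂ : ℝ)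
    (hA : A₁ + A₂ + A₃ + A₄ = B₁ + B₂) (hCre : u₁ + u₂ + u₃ + u₄ = v₁ + v₂) (hCim : x₁ + x₂ + x₃ + x₄ = y₁ + y₂)
    (hP1re : ((A₁ ^ 2 * u₁ + A₂ ^ 2 * u₂ + A₃ ^ 2 * u₃ + A₄ ^ 2 * u₄) - (B₁ ^ 2 * v₁ + B₂ ^ 2 * v₂) : ℝ) = 0)
    (hP1im : ((A₁ ^ 2 * x₁ + A₂ ^ 2 * x₂ + A₃ ^ 2 * x₃ + A₄ ^ 2 * x₄) - (B₁ ^ 2 * y₁ + B₂ ^ 2 * y₂) : ℝ) = 0)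
    (hP2re : ((A₁ * (u₁ ^ 2 - x₁ ^ 2) + A₂ * (u₂ ^ 2 - x₂ ^ 2) + A₃ * (u₃ ^ 2 - x₃ ^ 2) + A₄ * (u₄ ^ 2 - x₄ ^ 2)) - (B₁ * (v₁ ^ 2 - y₁ ^ 2) + B₂ * (v₂ ^ 2 - y₂ ^ 2)) : ℝ) = 0)
    (hP2im : ((A₁ * (2 * u₁ * x₁) + A₂ * (2 * u₂ * x₂) + A₃ * (2 * u₃ * x₃) + A₄ * (2 * u₄ * x₄)) - (B₁ * (2 * v₁ * y₁) + B₂ * (2 * v₂ * y₂)) : ℝ) = 0)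
    (hP3 : ((A₁ * (u₁ ^ 2 + x₁ ^ 2) + A₂ * (u₂ ^ 2 + x₂ ^ 2) + A₃ * (u₃ ^ 2 + x₃ ^ 2) + A₄ * (u₄ ^ 2 + x₄ ^ 2)) - (B₁ * (v₁ ^ 2 + y₁ ^ 2) + B₂ * (v₂ ^ 2 + y₂ ^ 2)) : ℝ) = 0)
    (hP4re : ((u₁ * (u₁ ^ 2 + x₁ ^ 2) + u₂ * (u₂ ^ 2 + x₂ ^ 2) + u₃ * (u₃ ^ 2 + x₃ ^ 2) + u₄ * (u₄ ^ 2 + x₄ ^ 2)) - (v₁ * (v₁ ^ 2 + y₁ ^ 2) + v₂ * (v₂ ^ 2 + y₂ ^ 2)) : ℝ) = 0)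
    (hP4im : ((x₁ * (u₁ ^ 2 + x₁ ^ 2) + x₂ * (u₂ ^ 2 + x₂ ^ 2) + x₃ * (u₃ ^ 2 + x₃ ^ 2) + x₄ * (u₄ ^ 2 + x₄ ^ 2)) - (y₁ * (v₁ ^ 2 + y₁ ^ 2) + y₂ * (v₂ ^ 2 + y₂ ^ 2)) : ℝ) = 0)
    (m₁₁ : Real.sqrt ((u₁ - v₁) ^ 2 + (x₁ - y₁) ^ 2) ≤ A₁ - B₁) (m₂₁ : Real.sqrt ((u₂ - v₁) ^ 2 + (x₂ - y₁) ^ 2) ≤ A₂ - B₁)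
    (m₃₁ : Real.sqrt ((u₃ - v₁) ^ 2 + (x₃ - y₁) ^ 2) ≤ A₃ - B₁) (m₄₁ : Real.sqrt ((u₄ - v₁) ^ 2 + (x₄ - y₁) ^ 2) ≤ A₄ - B₁)
    (m₁₂ : Real.sqrt ((u₁ - v₂) ^ 2 + (x₁ - y₂) ^ 2) ≤ A₁ - B₂) (m₂₂ : Real.sqrt ((u₂ - v₂) ^ 2 + (x₂ - y₂) ^ 2) ≤ A₂ - B₂)
    (m₃₂ : Real.sqrt ((u₃ - v₂) ^ 2 + (x₃ - y₂) ^ 2) ≤ A₃ - B₂) (m₄₂ : Real.sqrt ((u₄ - v₂) ^ 2 + (x₄ - y₂) ^ 2) ≤ A₄ - B₂)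
    :
    0 ≤ (1 / 2) * ((A₁ ^ 2 + A₂ ^ 2 + A₃ ^ 2 + A₄ ^ 2) - (B₁ ^ 2 + B₂ ^ 2) : ℝ) * (((u₁ ^ 2 + x₁ ^ 2) + (u₂ ^ 2 + x₂ ^ 2) + (u₃ ^ 2 + x₃ ^ 2) + (u₄ ^ 2 + x₄ ^ 2)) - ((v₁ ^ 2 + y₁ ^ 2) + (v₂ ^ 2 + y₂ ^ 2)) : ℝ)
        + (((A₁ * u₁ + A₂ * u₂ + A₃ * u₃ + A₄ * u₄) - (B₁ * v₁ + B₂ * v₂) : ℝ) ^ 2 + ((A₁ * x₁ + A₂ * x₂ + A₃ * x₃ + A₄ * x₄) - (B₁ * y₁ + B₂ * y₂) : ℝ) ^ 2)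
        - 3 * ((A₁ ^ 2 * (u₁ ^ 2 + x₁ ^ 2) + A₂ ^ 2 * (u₂ ^ 2 + x₂ ^ 2) + A₃ ^ 2 * (u₃ ^ 2 + x₃ ^ 2) + A₄ ^ 2 * (u₄ ^ 2 + x₄ ^ 2)) - (B₁ ^ 2 * (v₁ ^ 2 + y₁ ^ 2) + B₂ ^ 2 * (v₂ ^ 2 + y₂ ^ 2)) : ℝ)
      + (3 * (((u₁ ^ 2 + x₁ ^ 2) ^ 2 + (u₂ ^ 2 + x₂ ^ 2) ^ 2 + (u₃ ^ 2 + x₃ ^ 2) ^ 2 + (u₄ ^ 2 + x₄ ^ 2) ^ 2) - ((v₁ ^ 2 + y₁ ^ 2) ^ 2 + (v₂ ^ 2 + y₂ ^ 2) ^ 2) : ℝ)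
        - (((u₁ ^ 2 + x₁ ^ 2) + (u₂ ^ 2 + x₂ ^ 2) + (u₃ ^ 2 + x₃ ^ 2) + (u₄ ^ 2 + x₄ ^ 2)) - ((v₁ ^ 2 + y₁ ^ 2) + (v₂ ^ 2 + y₂ ^ 2)) : ℝ) ^ 2
        - (1 / 2) * ((((u₁ ^ 2 - x₁ ^ 2) + (u₂ ^ 2 - x₂ ^ 2) + (u₃ ^ 2 - x₃ ^ 2) + (u₄ ^ 2 - x₄ ^ 2)) - ((v₁ ^ 2 - y₁ ^ 2) + (v₂ ^ 2 - y₂ ^ 2)) : ℝ) ^ 2 + ((2 * u₁ * x₁ + 2 * u₂ * x₂ + 2 * u₃ * x₃ + 2 * u₄ * x₄) - (2 * v₁ * y₁ + 2 * v₂ * y₂) : ℝ) ^ 2)) := by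
  have h := conjectureN_42_complex_lambda A₁ A₂ A₃ A₄ B₁ B₂ u₁ u₂ u₃ u₄ v₁ v₂ x₁ x₂ x₃ x₄ y₁ y₂
    hA hCre hCim hP1re hP1im hP2re hP2im hP3 hP4re hP4im m₁₁ m₂₁ m₃₁ m₄₁ m₁₂ m₂₂ m₃₂ m₄₂ 1 (by norm_num) (by norm_num)
  simpa only [one_mul] using h

end Summit.HodgeConjecture.HodgeConjecture.WeilClassTestFormatFourTwoComplex
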